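import Summits.BirchSwinnertonDyer.BirchSwinnertonDyer.Theorems.EisensteinPrimesFullDescentMinkowskiGalois
import Literature.NumberTheory.NumberFields.ArtinMapDecompositionInertia
import Literature.NumberTheory.GaloisRepresentations.ArtinRestriction
import Literature.NumberTheory.EllipticCurves.KummerUnramified
import Mathlib.NumberTheory.Cyclotomic.Basic
import HarnessLib

/-!
# Crux `GoodLatticeBDPValue` (stmt-BirchSwinnertonDyer-19032), line `halves`, AN-3 Stub B road — brick F4d:
# MINKOWSKI OVER `ℚ(ζ₃)` in `Γ_ℚ`-currency: a homomorphism on `Stab(ζ₃) = Gal(ℚ̄/ℚ(ζ₃))` with open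
# kernel killing every inertia group is trivial

Width seat bsd-line-x1-p1-w3 (gen 4). HONEST FRAMING (cell `bsd-eis`, run/shared/lean/pub/bsd-eis/):
TOOL THEOREM ONLY (no `def`, no named fact, no `sorry`); classical algebraic number theory; nothing
about a summit statement, Keller–Yin Thm. 2.2.2 or crux 2 is proved here; 0 stubs / cells / labels move.

WHY (road memo `HOME/line-x1-p1-w3-g4/AN3-StubB-elementary-road.md`, global input (G-K) = hypothesis
`hGK` of the splitting lemma F5 `FullDescentSplitting.exists_stable_complement_mod`, p653931). This
file is the `Γ_ℚ`-currency form consumed by the assembly: `V = Stab_{Γ_ℚ}(ζ₃) = ker ω`, `η : V → A`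
a homomorphism killing an open normal `N ≤ Γ_ℚ` fixing `ζ₃` (the kernel of the action on `E[9]`)
and every `I_𝔓 ∩ V` ⟹ `η = 1`. Proof: in the finite Galois `L = ℚ̄^N` with group `G`
(bricks F4c's set-up), `H = Stab_G(ζ₃)` cuts out `ℚ(ζ₃)` (`|d| = 3`, degree `2`: Mathlib
`IsPrimitiveRoot.intermediateField_adjoin_isCyclotomicExtension`, `IsCyclotomicExtension.Rat.discr_prime`),
the inertia groups of `G` are images of the `I_𝔓` (tree
`inertia_comap_ringOfIntegers_eq_map_absRestrictNormalHom`), so brick F4b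
(`FullDescentMinkowski.subgroup_le_of_forall_inertia_inf_le`) gives `H ≤` (image of `ker η`), whence
`η = 1` (two lifts differ by `N`, killed by `η`).

* `monoidHom_eq_one_of_forall_inertia_of_stabilizer` — the statement above.

References: [NeukirchANT1999] Ch. III (2.17); [Cassels1986] Ch. 10 Thm. 12.1; [Washington1997] §2.
-/

set_option autoImplicit false
set_option linter.dupNamespace false

noncomputable section

open scoped Classical NumberField Pointwise

open Field IsDedekindDomain NumberField Module
  Literature.NumberTheory.EllipticCurves Literature.NumberTheory.GaloisRepresentations
  Literature.NumberTheory.NumberFields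

namespace Summit.BirchSwinnertonDyer.BirchSwinnertonDyer.Theorems.FullDescentMinkowski

/-- A prime of `\bar ℤ_K` above a given prime ideal of `𝓞 L`, for a number field `L ⊆ K̄`
(integrality of `\bar ℤ_K` over `𝓞 L`; copy of the MatarNekovar file's private helper). [folklore] -/
private theorem exists_isPrime_comap_eq {K : Type} [Field K]
    [NumberField K] (L : IntermediateField K (AlgebraicClosure K)) (Q : Ideal (𝓞 L))
    [Q.IsPrime] :
    ∃ 𝔓 : Ideal (absIntegers (𝓞 K) K), 𝔓.IsPrime ∧
      𝔓.comap (Literature.NumberTheory.EllipticCurves.ringOfIntegersToIntegralClosure (k := K)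
        (Ω := AlgebraicClosure K) L) = Q := by
  set φ : 𝓞 L →+* absIntegers (𝓞 K) K :=
    Literature.NumberTheory.EllipticCurves.ringOfIntegersToIntegralClosure (k := K)
      (Ω := AlgebraicClosure K) L with hφ
  have hφalg : ∀ x : 𝓞 K, φ (algebraMap (𝓞 K) (𝓞 L) x) =
      algebraMap (𝓞 K) (absIntegers (𝓞 K) K) x := fun x ↦ rfl
  letI : Algebra (𝓞 L) (absIntegers (𝓞 K) K) := φ.toAlgebra
  haveI : IsScalarTower (𝓞 K) (𝓞 L) (absIntegers (𝓞 K) K) :=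
    IsScalarTower.of_algebraMap_eq fun x ↦ (hφalg x).symm
  haveI : Algebra.IsIntegral (𝓞 L) (absIntegers (𝓞 K) K) :=
    ⟨fun x ↦ (Algebra.IsIntegral.isIntegral (R := 𝓞 K) x).tower_top⟩
  obtain ⟨𝔓, -, h𝔓prime, h𝔓Q⟩ := Ideal.exists_ideal_over_prime_of_isIntegral Q
    (⊥ : Ideal (absIntegers (𝓞 K) K))
    (fun x hx ↦ by
      rw [Ideal.mem_comap, Ideal.mem_bot] at hx
      have hx0 : x = 0 :=
        Literature.NumberTheory.EllipticCurves.ringOfIntegersToIntegralClosure_injective L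
          (hx.trans (map_zero _).symm)
      rw [hx0]
      exact Q.zero_mem)
  exact ⟨𝔓, h𝔓prime, h𝔓Q⟩

/-- **Minkowski over `ℚ(ζ₃)` in `Γ_ℚ`-currency.** Let `N ≤ Γ_ℚ` be open normal and fix a primitive
cube root of unity `ζ ∈ ℚ̄` fixed by `N`; let `V = Stab(ζ) ≤ Γ_ℚ` (`= Gal(ℚ̄/ℚ(ζ₃))`) and
`η : V →* A` a homomorphism which kills `N` and every `I_𝔓 ∩ V` (`𝔓` a maximal ideal of `\bar ℤ`).
Then `η = 1` — `ℚ(ζ₃)` has no extension unramified at all finite primes.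
[cite: NeukirchANT1999, Ch. III Thm. (2.17)] [cite: Cassels1986, Ch. 10 §12 Thm. 12.1] -/
theorem monoidHom_eq_one_of_forall_inertia_of_stabilizer
    (N : Subgroup (absoluteGaloisGroup ℚ)) [hN : N.Normal]
    (hopen : IsOpen (N : Set (absoluteGaloisGroup ℚ)))
    {ζ : AlgebraicClosure ℚ} (hζ : IsPrimitiveRoot ζ 3) (hNζ : ∀ σ ∈ N, σ • ζ = ζ)
    {A : Type*} [Group A] (η : MulAction.stabilizer (absoluteGaloisGroup ℚ) ζ →* A)
    (hηN : ∀ σ : MulAction.stabilizer (absoluteGaloisGroup ℚ) ζ, (σ : absoluteGaloisGroup ℚ) ∈ N → η σ = 1)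
    (hηI : ∀ (𝔓 : Ideal (absIntegers (𝓞 ℚ) ℚ)), 𝔓.IsMaximal →
      ∀ σ : MulAction.stabilizer (absoluteGaloisGroup ℚ) ζ,
        (σ : absoluteGaloisGroup ℚ) ∈ 𝔓.inertia (absoluteGaloisGroup ℚ) → η σ = 1) :
    η = 1 := by
  haveI : Fact (Nat.Prime 3) := ⟨Nat.prime_three⟩
  haveI : Algebra.IsAlgebraic ℚ (AlgebraicClosure ℚ) := AlgebraicClosure.isAlgebraic ℚ
  haveI : Normal ℚ (AlgebraicClosure ℚ) :=
    @IsAlgClosure.normal ℚ (AlgebraicClosure ℚ) _ _ (AlgebraicClosure.instAlgebra ℚ) inferInstance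
  haveI : IsGalois ℚ (AlgebraicClosure ℚ) :=
    @IsAlgClosure.isGalois ℚ (AlgebraicClosure ℚ) _ _ (AlgebraicClosure.instAlgebra ℚ) inferInstance
      inferInstance
  -- the fixed field `L = ℚ̄^N`
  set L := IntermediateField.fixedField N with hLdef
  have hLH : L.fixingSubgroup = N := fixingSubgroup_fixedField_of_isOpen N hopen
  haveI hfd' := finiteDimensional_fixedField_of_isOpen N hopen
  haveI hfd : FiniteDimensional ℚ L := hfd'
  have hnormal : L.fixingSubgroup.Normal := by rw [hLH]; exact hN
  haveI hGal' := (InfiniteGalois.normal_iff_isGalois L).mp hnormal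
  haveI hGal : IsGalois ℚ L := hGal'
  haveI : NumberField L := NumberField.mk
  set res := absRestrictNormalHom L with hres
  have hres_apply : ∀ (σ : absoluteGaloisGroup ℚ) (x : L),
      ((res σ x : L) : AlgebraicClosure ℚ) = σ • (x : AlgebraicClosure ℚ) := fun σ x ↦
    AlgEquiv.restrictNormalHom_apply L _ x
  have hker : ∀ σ : absoluteGaloisGroup ℚ, res σ = 1 ↔ σ ∈ N := by
    intro σ
    rw [hres, absRestrictNormalHom_eq_one_iff, hLH]
    rfl
  -- `ζ ∈ L`
  have hζL : ζ ∈ L := by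
    rw [hLdef, IntermediateField.mem_fixedField_iff]
    intro g hg
    exact hNζ g hg
  set ζL : L := ⟨ζ, hζL⟩ with hζLdef
  have hζL' : IsPrimitiveRoot ζL 3 :=
    hζ.of_map_of_injective (f := algebraMap L (AlgebraicClosure ℚ)) (algebraMap L _).injective
  -- the subgroups `H = Stab(ζ)` and `H' = res(ker η)` of `G = Gal(L/ℚ)`
  obtain ⟨H, hHdef⟩ : ∃ H : Subgroup (L ≃ₐ[ℚ] L), ∀ g : L ≃ₐ[ℚ] L, g ∈ H ↔ g ζL = ζL :=
    ⟨MulAction.stabilizer (L ≃ₐ[ℚ] L) ζL, fun g ↦ MulAction.mem_stabilizer_iff⟩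
  obtain ⟨H', hH'def⟩ : ∃ H' : Subgroup (L ≃ₐ[ℚ] L), ∀ g : L ≃ₐ[ℚ] L, g ∈ H' ↔
      ∃ σ : MulAction.stabilizer (absoluteGaloisGroup ℚ) ζ, η σ = 1 ∧ res (σ : absoluteGaloisGroup ℚ) = g := by
    refine ⟨{ carrier := {g | ∃ σ : MulAction.stabilizer (absoluteGaloisGroup ℚ) ζ,
                η σ = 1 ∧ res (σ : absoluteGaloisGroup ℚ) = g}
              mul_mem' := ?_, one_mem' := ?_, inv_mem' := ?_ }, fun g ↦ Iff.rfl⟩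
    · rintro a b ⟨σ, hσ, rfl⟩ ⟨τ, hτ, rfl⟩
      exact ⟨σ * τ, by rw [map_mul, hσ, hτ, one_mul], map_mul res _ _⟩
    · exact ⟨1, map_one η, map_one res⟩
    · rintro a ⟨σ, hσ, rfl⟩
      exact ⟨σ⁻¹, by rw [map_inv, hσ, inv_one], map_inv res _⟩
  -- (`res σ` lives in `L ≃ₐ[ℚ] L` for `IntermediateField.algebra`, `H` for `DivisionRing.toRatAlgebra`:
  -- the two agree definitionally, so we pass between them with `exact`, never with `rw`)
  have hmemH : ∀ σ : absoluteGaloisGroup ℚ, res σ ∈ H ↔ σ • ζ = ζ := fun σ ↦ by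
    refine (hHdef (res σ)).trans ?_
    have key : ((res σ ζL : L) : AlgebraicClosure ℚ) = (ζL : AlgebraicClosure ℚ) ↔ σ • ζ = ζ := by
      rw [hres_apply]
    exact Subtype.ext_iff.trans key
  -- the fixed field of `H` is `ℚ(ζ)`: degree `2`, discriminant `-3`
  have hKeq : (FixedPoints.intermediateField H : IntermediateField ℚ L) = IntermediateField.adjoin ℚ {ζL} := by
    have h1 : (IntermediateField.adjoin ℚ {ζL}).fixingSubgroup = H := by
      ext g
      rw [IntermediateField.mem_fixingSubgroup_iff, hHdef]
      constructor
      · intro h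
        exact h ζL (IntermediateField.mem_adjoin_simple_self ℚ ζL)
      · intro h x hx
        have hle : IntermediateField.adjoin ℚ {ζL} ≤ IntermediateField.fixedField H := by
          rw [IntermediateField.adjoin_simple_le_iff, IntermediateField.mem_fixedField_iff]
          intro f hf
          exact (hHdef f).mp hf
        have hx' := hle hx
        rw [IntermediateField.mem_fixedField_iff] at hx'
        exact hx' g ((hHdef g).mpr h)
    rw [← h1]
    exact IsGalois.fixedField_fixingSubgroup (IntermediateField.adjoin ℚ {ζL})
  haveI hcyc : IsCyclotomicExtension {3} ℚ (IntermediateField.adjoin ℚ {ζL}) :=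
    hζL'.intermediateField_adjoin_isCyclotomicExtension ℚ
  set e : (FixedPoints.intermediateField H : IntermediateField ℚ L) ≃ₐ[ℚ] (IntermediateField.adjoin ℚ {ζL}) :=
    IntermediateField.equivOfEq hKeq with hedef
  have hK : (discr (FixedPoints.intermediateField H : IntermediateField ℚ L)).natAbs = 3 := by
    rw [NumberField.discr_eq_discr_of_algEquiv _ e]
    have h3 := IsCyclotomicExtension.Rat.discr_prime 3 (IntermediateField.adjoin ℚ {ζL})
    norm_num at h3
    rw [h3]
    rfl
  have hK2 : finrank ℚ (FixedPoints.intermediateField H : IntermediateField ℚ L) = 2 := by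
    rw [e.toLinearEquiv.finrank_eq,
      IsCyclotomicExtension.finrank (n := 3) (IntermediateField.adjoin ℚ {ζL})
        (Polynomial.cyclotomic.irreducible_rat (by norm_num))]
    rfl
  -- the inertia groups of `G` meet `H` inside `H'`
  have hI : ∀ (Q : Ideal (𝓞 L)) [Q.IsMaximal], ∀ g : L ≃ₐ[ℚ] L,
      g ∈ Q.inertia (L ≃ₐ[ℚ] L) → g ∈ H → g ∈ H' := by
    intro Q hQmax g hg hgH
    obtain ⟨𝔓, h𝔓prime, h𝔓P⟩ := exists_isPrime_comap_eq L Q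
    subst h𝔓P
    haveI := h𝔓prime
    have h𝔓max : 𝔓.IsMaximal := by
      set φ : 𝓞 L →+* absIntegers (𝓞 ℚ) ℚ :=
        Literature.NumberTheory.EllipticCurves.ringOfIntegersToIntegralClosure (k := ℚ)
          (Ω := AlgebraicClosure ℚ) L with hφ
      letI : Algebra (𝓞 L) (absIntegers (𝓞 ℚ) ℚ) := φ.toAlgebra
      haveI : IsScalarTower (𝓞 ℚ) (𝓞 L) (absIntegers (𝓞 ℚ) ℚ) :=
        IsScalarTower.of_algebraMap_eq fun x ↦ rfl
      haveI : Algebra.IsIntegral (𝓞 L) (absIntegers (𝓞 ℚ) ℚ) :=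
        ⟨fun x ↦ (Algebra.IsIntegral.isIntegral (R := 𝓞 ℚ) x).tower_top⟩
      refine Ideal.isMaximal_of_isIntegral_of_isMaximal_comap (R := 𝓞 L) 𝔓 ?_
      exact hQmax
    have hg' : g ∈ (𝔓.inertia (absoluteGaloisGroup ℚ)).map res :=
      (le_of_eq (inertia_comap_ringOfIntegers_eq_map_absRestrictNormalHom L 𝔓)) hg
    obtain ⟨τ, hτ, rfl⟩ := hg'
    have hτζ : τ • ζ = ζ := (hmemH τ).mp hgH
    have h1 : η ⟨τ, hτζ⟩ = 1 := hηI 𝔓 h𝔓max ⟨τ, hτζ⟩ hτ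
    exact (hH'def _).mpr ⟨⟨τ, hτζ⟩, h1, rfl⟩
  -- Minkowski (brick F4b): `H ≤ H'`
  have hle : H ≤ H' := subgroup_le_of_forall_inertia_inf_le L (L ≃ₐ[ℚ] L) H H' hK hK2 hI
  -- conclusion
  ext σ
  have hσH : res (σ : absoluteGaloisGroup ℚ) ∈ H := (hmemH _).mpr σ.2
  obtain ⟨τ', hτ', hττ⟩ := (hH'def _).mp (hle hσH)
  -- `τ'` and `σ` have the same restriction, so differ by an element of `N`
  have hdiff : ((τ'⁻¹ * σ : MulAction.stabilizer (absoluteGaloisGroup ℚ) ζ) : absoluteGaloisGroup ℚ) ∈ N := by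
    rw [← hker, Subgroup.coe_mul, Subgroup.coe_inv, map_mul, map_inv, inv_mul_eq_one]
    exact hττ
  have h2 : η (τ'⁻¹ * σ) = 1 := hηN _ hdiff
  rw [map_mul, map_inv, hτ', inv_one, one_mul] at h2
  rw [h2, MonoidHom.one_apply]

end Summit.BirchSwinnertonDyer.BirchSwinnertonDyer.Theorems.FullDescentMinkowski
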